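import Summits.CriticalPhenomena.SAWScalingLimit.Theorems.CriticalBubbleBound.Negative.CriticalBubbleBoundPolygonSeries

/-!
# Negative-side results for the crux `SAWTotalPositivity.CriticalBubbleBound` (stmt-CriticalPhenomena-7117):
the UNROOTED polygon mass and the half-plane bubble (work-file §21)

`unrootedPolygonSeries` (`𝒫 := Σ_N q_N x_c^N`, polygons up to translation, "`θ > 1`") satisfies
`𝒫 ≤ T` (`unrootedPolygonSeries_le_polygonSeries`; `T = Σ_N N q_N x_c^N`, the crux by work-file §18)
and `𝒫 ≤ x_c · A` (`unrootedPolygonSeries_le_halfPlaneBubble`; `A = halfPlaneBubble`): every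
canonical SAP word (the tree's `Haruspicy.canonWords`: rooted at the lowest-then-leftmost vertex,
first letter `E`), read backwards with its last edge removed, is a half-plane arch `0 → e₀`
(`archOf`, injective: `archSigma_injective`). Hence `HalfPlaneBubbleFinite ⇒ 𝒫 < ∞` — the planner's
foreseen layer-2 crux `HalfPlaneBubble` and the cards' `UnrootedPolygonMassFinite` live at the
`θ > 1` level, one full power of `N` below the crux (`T`, `θ > 2`).

Refuter `cdisprove` (standing adversary, gen 4); the full indexed work file is
`Summits/CriticalPhenomena/SAWScalingLimit/Cruxes/CriticalBubbleBound/Disproof.lean` (§21).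
-/

noncomputable section

open MeasureTheory Filter Topology Set Function
open Literature.Probability.LatticeModels
open Literature.Probability.RandomPlanarGeometry Literature.Probability.RandomPlanarGeometry.SAW
open scoped ENNReal NNReal BigOperators

namespace Summit.CriticalPhenomena.SAWScalingLimit.Theorems.CriticalBubbleBound.Negative

open Summit.CriticalPhenomena.SAWScalingLimit.Theses.SAWTotalPositivity (CriticalBubbleBound)
open Literature.Barriers.CriticalPhenomena (polygonCount isotropicPolygonCount)
open Literature.Barriers.CriticalPhenomena.Edwards2D (stepVec StepSeq pos endpoint toWalk stepOf
  length_toWalk getVert_toWalk support_toWalk stepOf_add_stepVec)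
open Literature.Barriers.CriticalPhenomena.Haruspicy (vtx IsSAP IsRooted IsCanon canonWords
  wordsOfLength mem_wordsOfLength mem_canonWords key key_le_key rev inv isSAP_rev isRooted_rev
  rev_rev head?_rev inv_inv stepVec_inv length_rev unclose pos_unclose endpoint_unclose
  vtx_add_stepVec_last vtx_succ vtx_zero vtx_length polygonCount_eq_card_canonWords)

/-! ## §21 The UNROOTED polygon mass `𝒫 = Σ_N q_N x_c^N` sits below the half-plane bubble:
`𝒫 ≤ x_c · A` (canonical words are half-plane arches) and `𝒫 ≤ T` -/

/-- **`𝒫 := Σ_N q_N x_c^N ∈ [0,∞]`** — the critical mass of self-avoiding polygons up to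
translation (no root; "`θ > 1` summably"). The quantity the cards' `UnrootedPolygonMassFinite`,
`DyadicMassBound` and Hammond-joining bootstraps are about. [cite: MadrasSlade1993, Definition 3.2.2] -/
def unrootedPolygonSeries : ℝ≥0∞ :=
  ∑' N : ℕ, (isotropicPolygonCount N : ℝ≥0∞) * ENNReal.ofReal (criticalFugacity ^ N)

/-- `q_0 = 0`. [folklore] -/
theorem isotropicPolygonCount_zero : isotropicPolygonCount 0 = 0 := by
  rw [isotropicPolygonCount, if_pos (by decide), Finset.sum_eq_zero]
  intro m hm
  rw [Finset.mem_range] at hm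
  rw [polygonCount, Literature.Barriers.CriticalPhenomena.rootedPolygonCount, if_pos (by omega),
    Nat.zero_div]

/-- `𝒫 ≤ T`: dropping the root only loses the factor `N ≥ 1`. So the crux implies `𝒫 < ∞`. [folklore] -/
theorem unrootedPolygonSeries_le_polygonSeries : unrootedPolygonSeries ≤ polygonSeries := by
  refine ENNReal.tsum_le_tsum fun N => ?_
  gcongr
  rcases Nat.eq_zero_or_pos N with rfl | hN
  · simp [isotropicPolygonCount_zero]
  · exact_mod_cast Nat.le_mul_of_pos_left _ hN

/-! ### Canonical words are half-plane arches -/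

/-- `stepVec` is injective. [folklore] -/
theorem stepVec_injective' : Function.Injective stepVec := fun a b h => by
  have ha := stepOf_add_stepVec 0 a
  rw [h, stepOf_add_stepVec] at ha
  exact ha.symm

/-- Two step words with the same length and the same vertex function coincide. [folklore] -/
theorem eq_of_vtx_eq {u u' : List (Fin 4)} (hl : u.length = u'.length)
    (h : ∀ k, k ≤ u.length → vtx u k = vtx u' k) : u = u' := by
  apply List.ext_getElem hl
  intro i h1 h2
  apply stepVec_injective'
  have e1 := vtx_succ u h1
  have e2 := vtx_succ u' h2
  rw [h (i + 1) h1, h i h1.le] at e1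
  exact add_left_cancel (e1.symm.trans e2)

/-- The facts about a canonical word `w` (length `N`) used below: `N ≥ 4`; the reversed word
`rev w` is a rooted SAP word; its vertex `N - 1` is `e₀` (a canonical word STARTS with the letter
`E`, so read backwards the polygon returns to `0` from `e₀`); its vertex `N` is `0`. [folklore] -/
theorem canon_facts {w : List (Fin 4)} (hc : IsCanon w) :
    4 ≤ w.length ∧ IsSAP (rev w) ∧ IsRooted (rev w) ∧
      vtx (rev w) (w.length - 1) = e₀ ∧ vtx (rev w) w.length = 0 := by
  obtain ⟨hsap, hroot, hhead⟩ := hc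
  have hN : 4 ≤ w.length := hsap.1
  have hsap' := isSAP_rev hsap
  have hroot' := isRooted_rev hsap hroot
  refine ⟨hN, hsap', hroot', ?_, ?_⟩
  · -- last letter of `rev w` is `inv 0 = W`
    have hlast : (rev w).getLast? = some 1 := by
      have h := head?_rev (rev w)
      rw [rev_rev, hhead] at h
      cases hq : (rev w).getLast? with
      | none => rw [hq] at h; simp at h
      | some a =>
        rw [hq] at h
        simp only [Option.map_some, Option.some.injEq] at h
        have ha : a = 1 := by
          have := congrArg inv h
          rw [inv_inv] at this
          rw [← this]
          decide
        rw [ha]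
    have hlen : (rev w).length = (w.length - 1) + 1 := by rw [length_rev]; omega
    have key := vtx_add_stepVec_last hlen hsap'.2.1
    have hget : (rev w)[w.length - 1]'(by rw [length_rev]; omega) = 1 := by
      rw [List.getLast?_eq_getElem?, List.getElem?_eq_getElem (by rw [length_rev]; omega)] at hlast
      simp only [Option.some.injEq, length_rev] at hlast
      exact hlast
    rw [hget] at key
    have he₀ : e₀ = Pi.single 0 1 := by funext i; fin_cases i <;> rfl
    rw [eq_neg_of_add_eq_zero_left key, he₀]
    simp
  · rw [← length_rev w, vtx_length, hsap'.2.1]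

/-- The ARCH of a canonical word: the polygon read backwards from its root `0`, with the last
edge `{e₀, 0}` removed — a self-avoiding walk `0 → e₀` of length `N - 1` in the closed upper
half-plane (the root is the lowest-then-leftmost vertex). [folklore] -/
def archOf (w : List (Fin 4)) (hc : IsCanon w) : HalfPlaneSAW :=
  ⟨⟨(toWalk (unclose (rev w) : StepSeq (w.length - 1))).copy rfl
      (by rw [endpoint_unclose _ (by rw [length_rev]; omega), (canon_facts hc).2.2.2.1]), by
    rw [SimpleGraph.Walk.isPath_copy, ← SimpleGraph.Walk.IsPath.getVert_injOn_iff]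
    intro i hi j hj hij
    simp only [Set.mem_setOf_eq, length_toWalk] at hi hj
    have hle : w.length - 1 ≤ (rev w).length := by rw [length_rev]; omega
    rw [getVert_toWalk _ hi, getVert_toWalk _ hj, pos_unclose _ hle hi, pos_unclose _ hle hj] at hij
    have hinj := (canon_facts hc).2.1.2.2
    have h4 := (canon_facts hc).1
    exact hinj (by simp [length_rev]; omega) (by simp [length_rev]; omega) hij⟩, by
    intro v hv
    rw [SimpleGraph.Walk.support_copy, support_toWalk, List.mem_map] at hv
    obtain ⟨k, hk, rfl⟩ := hv
    rw [List.mem_range] at hk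
    have hle : w.length - 1 ≤ (rev w).length := by rw [length_rev]; omega
    rw [pos_unclose _ hle (by omega)]
    have h4 := (canon_facts hc).1
    have hr := (canon_facts hc).2.2.1 k (by rw [length_rev]; omega)
    rw [key_le_key] at hr
    simp only [Pi.zero_apply] at hr
    omega⟩

/-- The arch has length `N - 1`. [folklore] -/
theorem length_archOf (w : List (Fin 4)) (hc : IsCanon w) :
    (archOf w hc).1.1.length = w.length - 1 := by
  simp [archOf, length_toWalk]

/-- The vertices of the arch are those of the reversed word. [folklore] -/
theorem getVert_archOf (w : List (Fin 4)) (hc : IsCanon w) {k : ℕ} (hk : k ≤ w.length - 1) :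
    (archOf w hc).1.1.getVert k = vtx (rev w) k := by
  simp only [archOf, SimpleGraph.Walk.getVert_copy]
  rw [getVert_toWalk _ hk, pos_unclose _ (by rw [length_rev]; omega) hk]

/-- **Canonical words ↪ half-plane arches**: the arch determines the word (among canonical
words of the same length). [folklore] -/
theorem archOf_inj {w w' : List (Fin 4)} (hc : IsCanon w) (hc' : IsCanon w')
    (hl : w.length = w'.length) (h : archOf w hc = archOf w' hc') : w = w' := by
  have hv : ∀ k, k ≤ w.length - 1 → vtx (rev w) k = vtx (rev w') k := by
    intro k hk
    rw [← getVert_archOf w hc hk, ← getVert_archOf w' hc' (by omega), h]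
  have hrev : rev w = rev w' := by
    refine eq_of_vtx_eq (by rw [length_rev, length_rev, hl]) fun k hk => ?_
    rw [length_rev] at hk
    rcases Nat.lt_or_ge k w.length with hlt | hge
    · exact hv k (by omega)
    · have hk' : k = w.length := le_antisymm hk hge
      rw [hk', (canon_facts hc).2.2.2.2, hl, (canon_facts hc').2.2.2.2]
  rw [← rev_rev w, hrev, rev_rev]

/-! ### Counting: `q_N ≤ #{canonical words of length N} ≤ #{arches of length N-1}` -/

open Classical in
/-- All canonical words of length `N` (any number of horizontal letters). [folklore] -/
def canonSet (N : ℕ) : Finset (List (Fin 4)) := (wordsOfLength N).filter IsCanon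

/-- Membership in `canonSet`. [folklore] -/
theorem mem_canonSet {N : ℕ} {w : List (Fin 4)} : w ∈ canonSet N ↔ w.length = N ∧ IsCanon w := by
  classical
  simp [canonSet, mem_wordsOfLength]

/-- `q_N ≤ #canonSet N` (equality in fact: the horizontal classes partition the canonical words). [cite: MadrasSlade1993, Definition 3.2.2] -/
theorem isotropicPolygonCount_le_card_canonSet (N : ℕ) :
    isotropicPolygonCount N ≤ (canonSet N).card := by
  classical
  rw [isotropicPolygonCount]
  split_ifs with hN
  · obtain ⟨K, rfl⟩ := hN
    rw [show (K + K) / 2 = K by omega]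
    have hdisj : (↑(Finset.range (K + 1)) : Set ℕ).PairwiseDisjoint
        fun m => canonWords (K + K) (2 * m) := by
      intro m _ m' _ hmm'
      refine Finset.disjoint_left.2 fun w hw hw' => hmm' ?_
      rw [mem_canonWords] at hw hw'
      omega
    calc ∑ m ∈ Finset.range (K + 1), polygonCount m (K - m)
        = ∑ m ∈ Finset.range (K + 1), (canonWords (K + K) (2 * m)).card := by
          refine Finset.sum_congr rfl fun m hm => ?_
          rw [Finset.mem_range] at hm
          rw [polygonCount_eq_card_canonWords, show 2 * (m + (K - m)) = K + K by omega]
      _ = ((Finset.range (K + 1)).biUnion fun m => canonWords (K + K) (2 * m)).card :=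
          (Finset.card_biUnion hdisj).symm
      _ ≤ (canonSet (K + K)).card := by
          refine Finset.card_le_card fun w hw => ?_
          rw [Finset.mem_biUnion] at hw
          obtain ⟨m, -, hm⟩ := hw
          rw [mem_canonWords] at hm
          exact mem_canonSet.2 ⟨hm.1, hm.2.1⟩
  · exact Nat.zero_le _

/-! ### The series inequality `𝒫 ≤ x_c · A` -/

/-- The sigma type of canonical words indexed by length. [folklore] -/
abbrev CanonSigma : Type := Σ N : ℕ, canonSet N

/-- The global arch map on canonical words of all lengths. [folklore] -/
def archSigma (p : CanonSigma) : HalfPlaneSAW := archOf p.2.1 (mem_canonSet.1 p.2.2).2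

/-- The global arch map is injective (the length of the arch recovers `N = |arch| + 1`). [folklore] -/
theorem archSigma_injective : Function.Injective archSigma := by
  rintro ⟨N, w, hw⟩ ⟨N', w', hw'⟩ h
  have hwN := (mem_canonSet.1 hw).1
  have hwN' := (mem_canonSet.1 hw').1
  have hc := (mem_canonSet.1 hw).2
  have hc' := (mem_canonSet.1 hw').2
  have hlen : w.length = w'.length := by
    have h1 := congrArg (fun q : HalfPlaneSAW => q.1.1.length) h
    simp only [archSigma, length_archOf] at h1
    have := (canon_facts hc).1
    have := (canon_facts hc').1
    omega
  have hNN : N = N' := by rw [← hwN, ← hwN', hlen]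
  subst hNN
  have hww : w = w' := archOf_inj hc hc' hlen h
  subst hww
  rfl

/-- **`𝒫 ≤ x_c · A`**: the unrooted critical polygon mass is at most `x_c` times the half-plane
bubble — every polygon class, read backwards from its lowest-leftmost vertex, is `x_c^{|arch|+1}`
with `arch` a half-plane SAW `0 → e₀`, injectively. Hence `HalfPlaneBubbleFinite ⇒ 𝒫 < ∞`
(the infinite-volume half of the cards' `BumpEquivalence`), and the planner's foreseen layer-2
crux `HalfPlaneBubble` delivers exactly the `θ > 1` level (`𝒫`), one full power of `N` below the
crux (`T`, §18). [cite: MadrasSlade1993, Definition 3.2.2 and §1.4] -/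
theorem unrootedPolygonSeries_le_halfPlaneBubble :
    unrootedPolygonSeries ≤ ENNReal.ofReal criticalFugacity * halfPlaneBubble := by
  classical
  have hx0 : 0 ≤ criticalFugacity := criticalFugacity_pos_lt_one'.1.le
  set X : ℕ → ℝ≥0∞ := fun n => ENNReal.ofReal (criticalFugacity ^ n) with hX
  -- Step 1: `q_N X N ≤ #canonSet N · X N = Σ_{w ∈ canonSet N} X N`
  have h1 : unrootedPolygonSeries ≤ ∑' p : CanonSigma, X p.1 := by
    rw [unrootedPolygonSeries, ENNReal.tsum_sigma']
    refine ENNReal.tsum_le_tsum fun N => ?_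
    show _ ≤ ∑' b : canonSet N, X N
    rw [tsum_fintype, Finset.sum_const, Finset.card_univ, Fintype.card_coe, nsmul_eq_mul]
    gcongr
    exact_mod_cast isotropicPolygonCount_le_card_canonSet N
  -- Step 2: `X N = x_c · x_c^{|arch|}` along the injective arch map
  have h2 : ∀ p : CanonSigma, X p.1 =
      ENNReal.ofReal criticalFugacity * ENNReal.ofReal (criticalFugacity ^ (archSigma p).1.1.length) := by
    rintro ⟨N, w, hw⟩
    have hwN := (mem_canonSet.1 hw).1
    have hc := (mem_canonSet.1 hw).2
    have h4 := (canon_facts hc).1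
    simp only [hX, archSigma, length_archOf]
    rw [← ENNReal.ofReal_mul hx0, ← pow_succ', ← hwN, Nat.sub_add_cancel (by omega)]
  calc unrootedPolygonSeries ≤ ∑' p : CanonSigma, X p.1 := h1
    _ = ∑' p : CanonSigma, ENNReal.ofReal criticalFugacity *
          (fun q : HalfPlaneSAW => ENNReal.ofReal (criticalFugacity ^ q.1.1.length)) (archSigma p) :=
        tsum_congr h2
    _ = ENNReal.ofReal criticalFugacity * ∑' p : CanonSigma,
          (fun q : HalfPlaneSAW => ENNReal.ofReal (criticalFugacity ^ q.1.1.length)) (archSigma p) :=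
        ENNReal.tsum_mul_left
    _ ≤ ENNReal.ofReal criticalFugacity * halfPlaneBubble := by
        rw [halfPlaneBubble]
        gcongr
        exact ENNReal.tsum_comp_le_tsum_of_injective archSigma_injective _

/-- `HalfPlaneBubbleFinite ⇒ 𝒫 < ∞`. [folklore] -/
theorem unrootedPolygonSeries_ne_top_of_halfPlaneBubbleFinite (h : HalfPlaneBubbleFinite) :
    unrootedPolygonSeries ≠ ⊤ :=
  ne_top_of_le_ne_top (ENNReal.mul_ne_top ENNReal.ofReal_ne_top h)
    unrootedPolygonSeries_le_halfPlaneBubble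

/-- `CriticalBubbleBound ⇒ 𝒫 < ∞` (through `T`, §18). [folklore] -/
theorem unrootedPolygonSeries_ne_top_of_criticalBubbleBound (h : CriticalBubbleBound) :
    unrootedPolygonSeries ≠ ⊤ :=
  ne_top_of_le_ne_top (criticalBubbleBound_iff_polygonSeries_ne_top.1 h)
    unrootedPolygonSeries_le_polygonSeries

end Summit.CriticalPhenomena.SAWScalingLimit.Theorems.CriticalBubbleBound.Negative
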